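import Summits.CriticalPhenomena.PercolationContinuityZ3.Theorems.PercNearOneGluingNoHeavyQuantCombMoveTop
import HarnessLib

/-!
# QUANT lane R8 — gluing a tied hair below the distinguished relay of a comb (the SPLICE endpoint at the bottom level)

builds on p205010 (kernel theorem, internal audit signed; external expert review pending)

Support file (`--supports stmt-CriticalPhenomena-4575`), QUANT lane lead (gen 9), rung R8 of `run/shared/lean/prim/quant/LADDER.md`;
memo `prim-quant-lead-g9/LEAD-NOTES-G9.md` N20 step (4) — ninth file of the kernel proof of FAR (`Quant.FarTreeRow`) at EVERY layer on
COMBS.  When the hair `b` is TIED with the distinguished relay `a` (`T_b = T_a`), its splice position is below `a`: `P' b = P a ∪ {b}` with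
gate `q' b = 1`, everything else unchanged, and `b` becomes the new distinguished relay (spine `P' b`).  Theorems only; no sorries.

* `Quant.comb_glue_light_eq` — the cost: `P_{q'}(#{z ∈ A | P' z open} ≤ j) = P_q(#{z ∈ A ∖ b | P z open} ≤ j) − e_d`,
  `e_d = P_q(#{z ∈ A ∖ b | P z open} = j ∧ P a open)` (`d = #(P a)`).
* `Quant.comb_glue_spine`, `Quant.comb_glue_relays`, `Quant.comb_glue_marginal`, `Quant.comb_glue_measure` — the comb hypotheses for the
  new spine `P' b`, unchanged marginals (`∏_{P' b} q' = ∏_{P a} q`), and the drop of the positive-level hair count.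
[this work]
-/

noncomputable section

namespace Summit.CriticalPhenomena.PercolationContinuityZ3.Theorems

namespace Quant

open Finset MeasureTheory
open Literature.Probability.LatticeModels
open Literature.Probability.Percolation
open scoped Classical

variable {ι : Type*} [Fintype ι]

/-- **The cost of gluing `b` below `a`.** [this work] -/
theorem comb_glue_light_eq (q q' : ι → unitInterval) (P P' : ι → Finset ι) (a : ι) (A : Finset ι) (j : ℕ) {b : ι}
    (hsp : ∀ y ∈ P a, y ∈ P y ∧ P y ⊆ P a ∧ ∀ y' ∈ P a,
      (y ∈ P y' ∨ y' ∈ P y) ∧ (y ∈ P y' → P y ⊆ P y') ∧ (y ∈ P y' → y' ∈ P y → y = y'))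
    (hA5 : ∀ z ∈ A, ∀ y ∈ P z, y ∈ P a → P y ⊆ P z)
    (hA6 : ∀ z ∈ A, ∀ z' ∈ A, z ≠ z' → Disjoint (P z \ P a) (P z' \ P a))
    (hbA : b ∈ A) (hba : b ∉ P a) (hbb : b ∈ P b)
    (hP'b : P' b = insert b (P a)) (hP' : ∀ x, x ≠ b → P' x = P x) (hq' : ∀ i, i ≠ b → q' i = q i) (hq'b : (q' b : ℝ) = 1) :
    (prodBernoulli q').real {ω : Set ι | (A.filter fun z => ((P' z : Finset ι) : Set ι) ⊆ ω).card ≤ j} =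
      (prodBernoulli q).real {ω : Set ι | ((A.erase b).filter fun z => ((P z : Finset ι) : Set ι) ⊆ ω).card ≤ j} -
        (prodBernoulli q).real {ω : Set ι | ((A.erase b).filter fun z => ((P z : Finset ι) : Set ι) ⊆ ω).card = j ∧
          (((P a).filter (fun y => (P y).card ≤ (P a).card) : Finset ι) : Set ι) ⊆ ω} := by
  have hmeas : ∀ T : Set (Set ι), MeasurableSet T := fun T => (Set.toFinite T).measurableSet
  obtain ⟨hP'a, hP'y, hsp'⟩ := comb_top_spine P P' a hba hbb hP' hsp
  have hA5' : ∀ z ∈ A.erase b, ∀ y ∈ P' z, y ∈ P' a → P' y ⊆ P' z := by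
    intro z hz y hy hya
    have hzb : z ≠ b := Finset.ne_of_mem_erase hz
    rw [hP' z hzb] at hy ⊢
    rw [hP'a] at hya
    rw [hP'y y hya]
    exact hA5 z (Finset.mem_of_mem_erase hz) y hy hya
  have hbdown : ∀ y ∈ P' b, y ∈ P' a → P' y ⊆ P' b := by
    intro y _ hya
    rw [hP'a] at hya
    rw [hP'y y hya, hP'b]
    exact (hsp y hya).2.1.trans (Finset.subset_insert _ _)
  have hQ : P' b \ P' a = {b} := by
    rw [hP'b, hP'a, Finset.insert_sdiff_of_notMem _ hba, Finset.sdiff_self, Finset.insert_empty]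
  have hbdisj : ∀ z ∈ A.erase b, Disjoint (P' z \ P' a) (P' b \ P' a) := by
    intro z hz
    rw [hQ, hP' z (Finset.ne_of_mem_erase hz), hP'a, Finset.disjoint_singleton_right, Finset.mem_sdiff, not_and_or]
    exact Or.inl (comb_hair_tip_notMem P a A hbA hba hbb hA6 (Finset.mem_of_mem_erase hz) (Finset.ne_of_mem_erase hz))
  have key := comb_hair_conditioning q' P' a (A.erase b) j (Finset.notMem_erase b A) hsp' hA5' hbdown hbdisj
  rw [Finset.insert_erase hbA] at key
  rw [key, hQ, Finset.prod_singleton, hq'b, one_mul]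
  have hlev : (P' b ∩ P' a).card = (P a).card := by
    rw [hP'b, hP'a, Finset.insert_inter_of_notMem hba, Finset.inter_self]
  have hSd : (P' a).filter (fun y => (P' y).card ≤ (P' b ∩ P' a).card) = (P a).filter (fun y => (P y).card ≤ (P a).card) := by
    rw [hlev, hP'a]
    exact Finset.filter_congr fun y hy => by rw [hP'y y hy]
  have hfilt : ∀ ω : Set ι, ((A.erase b).filter fun z => ((P' z : Finset ι) : Set ι) ⊆ ω) =
      ((A.erase b).filter fun z => ((P z : Finset ι) : Set ι) ⊆ ω) := fun ω =>
    Finset.filter_congr fun z hz => by rw [hP' z (Finset.ne_of_mem_erase hz)]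
  set G : Finset ι := (A.erase b).biUnion P ∪ P a with hG
  have hbG : b ∉ G := by
    rw [hG, Finset.mem_union, Finset.mem_biUnion, not_or]
    refine ⟨?_, hba⟩
    rintro ⟨z, hz, hbz⟩
    exact comb_hair_tip_notMem P a A hbA hba hbb hA6 (Finset.mem_of_mem_erase hz) (Finset.ne_of_mem_erase hz) hbz
  have hqG : ∀ i ∈ (↑G : Set ι), q' i = q i := fun i hi => hq' i (fun h => hbG (h ▸ Finset.mem_coe.1 hi))
  have dL : ∀ Φ : ℕ → Prop, DeterminedBy {ω : Set ι | Φ (((A.erase b).filter fun z => ((P z : Finset ι) : Set ι) ⊆ ω).card)} (↑G : Set ι) :=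
    fun Φ => (determinedBy_card_filter_open (A.erase b) P ((A.erase b).biUnion P)
      (fun z hz => Finset.subset_biUnion_of_mem P hz) Φ).mono (by rw [hG]; exact Finset.coe_subset.2 Finset.subset_union_left)
  have dS : DeterminedBy {ω : Set ι | (((P a).filter (fun y => (P y).card ≤ (P a).card) : Finset ι) : Set ι) ⊆ ω} (↑G : Set ι) :=
    (determinedBy_subset_open _).mono (Finset.coe_subset.2 ((Finset.filter_subset _ _).trans
      (by rw [hG]; exact Finset.subset_union_right)))
  have e1 : (prodBernoulli q').real {ω : Set ι | ((A.erase b).filter fun z => ((P' z : Finset ι) : Set ι) ⊆ ω).card ≤ j} =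
      (prodBernoulli q).real {ω : Set ι | ((A.erase b).filter fun z => ((P z : Finset ι) : Set ι) ⊆ ω).card ≤ j} := by
    simp only [hfilt]
    exact prodBernoulli_real_eq_of_determinedBy q' q hqG (dL fun c => c ≤ j) (hmeas _)
  have e2 : (prodBernoulli q').real {ω : Set ι | ((A.erase b).filter fun z => ((P' z : Finset ι) : Set ι) ⊆ ω).card = j ∧
        (((P' a).filter (fun y => (P' y).card ≤ (P' b ∩ P' a).card) : Finset ι) : Set ι) ⊆ ω} =
      (prodBernoulli q).real {ω : Set ι | ((A.erase b).filter fun z => ((P z : Finset ι) : Set ι) ⊆ ω).card = j ∧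
        (((P a).filter (fun y => (P y).card ≤ (P a).card) : Finset ι) : Set ι) ⊆ ω} := by
    simp only [hfilt, hSd]
    have : {ω : Set ι | ((A.erase b).filter fun z => ((P z : Finset ι) : Set ι) ⊆ ω).card = j ∧
        (((P a).filter (fun y => (P y).card ≤ (P a).card) : Finset ι) : Set ι) ⊆ ω} =
        {ω : Set ι | ((A.erase b).filter fun z => ((P z : Finset ι) : Set ι) ⊆ ω).card = j} ∩
          {ω | (((P a).filter (fun y => (P y).card ≤ (P a).card) : Finset ι) : Set ι) ⊆ ω} := by ext ω; simp
    rw [this]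
    exact prodBernoulli_real_eq_of_determinedBy q' q hqG ((dL fun c => c = j).inter dS) (hmeas _)
  rw [e1, e2]

omit [Fintype ι] in
/-- **The new spine `P' b = P a ∪ {b}` is an unglued chain with down-closed prefixes.** [this work] -/
theorem comb_glue_spine (P P' : ι → Finset ι) (a : ι) {b : ι} (hba : b ∉ P a) (hbb : b ∈ P b)
    (hP'b : P' b = insert b (P a)) (hP' : ∀ x, x ≠ b → P' x = P x)
    (hsp : ∀ y ∈ P a, y ∈ P y ∧ P y ⊆ P a ∧ ∀ y' ∈ P a,
      (y ∈ P y' ∨ y' ∈ P y) ∧ (y ∈ P y' → P y ⊆ P y') ∧ (y ∈ P y' → y' ∈ P y → y = y')) :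
    ∀ y ∈ P' b, y ∈ P' y ∧ P' y ⊆ P' b ∧ ∀ y' ∈ P' b,
      (y ∈ P' y' ∨ y' ∈ P' y) ∧ (y ∈ P' y' → P' y ⊆ P' y') ∧ (y ∈ P' y' → y' ∈ P' y → y = y') := by
  have hP'y : ∀ y ∈ P a, P' y = P y := fun y hy => hP' y (fun h => hba (h ▸ hy))
  have hby : ∀ y ∈ P a, b ∉ P y := fun y hy h => hba ((hsp y hy).2.1 h)
  rw [hP'b]
  intro y hy
  rw [Finset.mem_insert] at hy
  rcases hy with rfl | hy
  · refine ⟨by rw [hP'b]; exact Finset.mem_insert_self _ _, by rw [hP'b], fun y' hy' => ?_⟩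
    rw [Finset.mem_insert] at hy'
    rcases hy' with rfl | hy'
    · exact ⟨Or.inl (by rw [hP'b]; exact Finset.mem_insert_self _ _), fun _ => le_rfl, fun _ _ => rfl⟩
    · rw [hP'y y' hy']
      exact ⟨Or.inr (by rw [hP'b]; exact Finset.mem_insert_of_mem hy'), fun h => absurd h (hby y' hy'),
        fun h => absurd h (hby y' hy')⟩
  · obtain ⟨h1, h2, h3⟩ := hsp y hy
    rw [hP'y y hy]
    refine ⟨h1, h2.trans (Finset.subset_insert _ _), fun y' hy' => ?_⟩
    rw [Finset.mem_insert] at hy'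
    rcases hy' with rfl | hy'
    · rw [hP'b]
      exact ⟨Or.inl (Finset.mem_insert_of_mem hy), fun _ => h2.trans (Finset.subset_insert _ _),
        fun _ h => absurd h (hby y hy)⟩
    · rw [hP'y y' hy']; exact h3 y' hy'

omit [Fintype ι] in
/-- Relays after the glue: spine parts down-closed w.r.t. the new spine, private parts unchanged off `b`, tips stay. [this work] -/
theorem comb_glue_relays (P P' : ι → Finset ι) (a : ι) (A : Finset ι) {b : ι} (hbA : b ∈ A) (hba : b ∉ P a) (hbb : b ∈ P b)
    (hP'b : P' b = insert b (P a)) (hP' : ∀ x, x ≠ b → P' x = P x)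
    (hsp : ∀ y ∈ P a, y ∈ P y ∧ P y ⊆ P a ∧ ∀ y' ∈ P a,
      (y ∈ P y' ∨ y' ∈ P y) ∧ (y ∈ P y' → P y ⊆ P y') ∧ (y ∈ P y' → y' ∈ P y → y = y'))
    (hA5 : ∀ z ∈ A, ∀ y ∈ P z, y ∈ P a → P y ⊆ P z)
    (hA6 : ∀ z ∈ A, ∀ z' ∈ A, z ≠ z' → Disjoint (P z \ P a) (P z' \ P a))
    (hA8 : ∀ z ∈ A, z ∈ P z) :
    (∀ z ∈ A, z ≠ b → P' z \ P' b = P z \ P a) ∧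
    (∀ z ∈ A, ∀ y ∈ P' z, y ∈ P' b → P' y ⊆ P' z) ∧
    (∀ z ∈ A, ∀ z' ∈ A, z ≠ z' → Disjoint (P' z \ P' b) (P' z' \ P' b)) ∧
    (∀ z ∈ A, z ∈ P' z) := by
  have hP'y : ∀ y ∈ P a, P' y = P y := fun y hy => hP' y (fun h => hba (h ▸ hy))
  have hbz : ∀ {z : ι}, z ∈ A → z ≠ b → b ∉ P z := fun hz hzb => comb_hair_tip_notMem P a A hbA hba hbb hA6 hz hzb
  have hQ : ∀ z ∈ A, z ≠ b → P' z \ P' b = P z \ P a := by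
    intro z hz hzb
    rw [hP' z hzb, hP'b]
    ext y; simp only [Finset.mem_sdiff, Finset.mem_insert, not_or]
    constructor
    · rintro ⟨h1, -, h2⟩; exact ⟨h1, h2⟩
    · rintro ⟨h1, h2⟩; exact ⟨h1, fun h => hbz hz hzb (h ▸ h1), h2⟩
  have hQb : P' b \ P' b = ∅ := Finset.sdiff_self _
  refine ⟨hQ, ?_, ?_, ?_⟩
  · intro z hz y hy hyb
    rw [hP'b, Finset.mem_insert] at hyb
    by_cases hzb : z = b
    · subst hzb
      rcases hyb with rfl | hya
      · exact le_rfl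
      · rw [hP'y y hya, hP'b]; exact (hsp y hya).2.1.trans (Finset.subset_insert _ _)
    · rw [hP' z hzb] at hy ⊢
      rcases hyb with rfl | hya
      · exact absurd hy (hbz hz hzb)
      · rw [hP'y y hya]; exact hA5 z hz y hy hya
  · intro z hz z' hz' hne
    by_cases hzb : z = b
    · subst hzb; rw [hQb]; exact Finset.disjoint_empty_left _
    by_cases hz'b : z' = b
    · subst hz'b; rw [hQb]; exact Finset.disjoint_empty_right _
    rw [hQ z hz hzb, hQ z' hz' hz'b]; exact hA6 z hz z' hz' hne
  · intro z hz
    by_cases hzb : z = b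
    · subst hzb; rw [hP'b]; exact Finset.mem_insert_self _ _
    · rw [hP' z hzb]; exact hA8 z hz

omit [Fintype ι] in
/-- Marginals after the glue: `∏_{P' b} q' = ∏_{P a} q` and every other marginal is unchanged. [this work] -/
theorem comb_glue_marginal (q q' : ι → unitInterval) (P P' : ι → Finset ι) (a : ι) (A : Finset ι) {b : ι}
    (hbA : b ∈ A) (hba : b ∉ P a) (hbb : b ∈ P b) (hP'b : P' b = insert b (P a)) (hP' : ∀ x, x ≠ b → P' x = P x)
    (hq' : ∀ i, i ≠ b → q' i = q i) (hq'b : (q' b : ℝ) = 1)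
    (hA6 : ∀ z ∈ A, ∀ z' ∈ A, z ≠ z' → Disjoint (P z \ P a) (P z' \ P a)) :
    (∏ y ∈ P' b, (q' y : ℝ)) = ∏ y ∈ P a, (q y : ℝ) ∧
      ∀ z ∈ A, z ≠ b → (∏ y ∈ P' z, (q' y : ℝ)) = ∏ y ∈ P z, (q y : ℝ) := by
  have hprod : ∀ S : Finset ι, b ∉ S → (∏ y ∈ S, (q' y : ℝ)) = ∏ y ∈ S, (q y : ℝ) := fun S hS =>
    Finset.prod_congr rfl fun y hy => by rw [hq' y (fun h => hS (h ▸ hy))]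
  refine ⟨by rw [hP'b, Finset.prod_insert hba, hq'b, one_mul, hprod (P a) hba], fun z hz hzb => ?_⟩
  rw [hP' z hzb, hprod (P z) (comb_hair_tip_notMem P a A hbA hba hbb hA6 hz hzb)]

omit [Fintype ι] in
/-- The positive-level hair count (w.r.t. the new spine) loses `b`. [this work] -/
theorem comb_glue_measure (P P' : ι → Finset ι) (a : ι) (A : Finset ι) {b : ι} (hbA : b ∈ A) (hba : b ∉ P a) (hbb : b ∈ P b)
    (hP'b : P' b = insert b (P a)) (hP' : ∀ x, x ≠ b → P' x = P x)
    (hA6 : ∀ z ∈ A, ∀ z' ∈ A, z ≠ z' → Disjoint (P z \ P a) (P z' \ P a)) :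
    A.filter (fun z => ¬ P' z ⊆ P' b ∧ (P' z ∩ P' b).Nonempty) =
      (A.filter fun z => ¬ P z ⊆ P a ∧ (P z ∩ P a).Nonempty).erase b := by
  have hbz : ∀ {z : ι}, z ∈ A → z ≠ b → b ∉ P z := fun hz hzb => comb_hair_tip_notMem P a A hbA hba hbb hA6 hz hzb
  ext z
  rw [Finset.mem_erase, Finset.mem_filter, Finset.mem_filter, hP'b]
  constructor
  · rintro ⟨hz, h1, h2⟩
    have hzb : z ≠ b := by rintro rfl; exact h1 (by rw [hP'b])
    rw [hP' z hzb] at h1 h2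
    refine ⟨hzb, hz, fun h => h1 (h.trans (Finset.subset_insert _ _)), ?_⟩
    obtain ⟨y, hy⟩ := h2
    rw [Finset.mem_inter, Finset.mem_insert] at hy
    rcases hy.2 with h | h
    · exact absurd (h ▸ hy.1) (hbz hz hzb)
    · exact ⟨y, Finset.mem_inter.2 ⟨hy.1, h⟩⟩
  · rintro ⟨hzb, hz, h1, h2⟩
    rw [hP' z hzb]
    refine ⟨hz, fun hsub => h1 fun y hy => ?_, ?_⟩
    · have := hsub hy
      rw [Finset.mem_insert] at this
      rcases this with h | h
      · exact absurd (h ▸ hy) (hbz hz hzb)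
      · exact h
    · obtain ⟨y, hy⟩ := h2
      exact ⟨y, Finset.mem_inter.2 ⟨(Finset.mem_inter.1 hy).1, Finset.mem_insert_of_mem (Finset.mem_inter.1 hy).2⟩⟩

end Quant

end Summit.CriticalPhenomena.PercolationContinuityZ3.Theorems

end
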